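import Summits.FinalStateConjecture.FinalStateConjecture.Theorems.SeamedChartsExhaust.Negative.KerrSchildTimeFunction
import Literature.Geometry.Lorentzian.SchwarzschildKerrSchildComponents
import Mathlib.Analysis.SpecialFunctions.Sqrt
import Mathlib.Analysis.InnerProductSpace.Calculus
import HarnessLib

/-!
# Route PhotonSphereChannels · crux `ChannelsResolveTameDevelopmentsR` (K2R-T2, stmt-FinalStateConjecture-17430) —
# the SCHWARZSCHILD END, IV-d: the clock-adapted ball chart
# `Φ(y) = q + A y + (F(r(q)) − F(r(q + A y))) ∂_{t*}` of the Kerr–Schild patch — a homeomorphism of `E4`,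
# smooth off the axis, with differential `dΦ_y u = A u − F'(ρ) (⟪x⃗, (A u)⃗⟫/ρ) ∂_{t*}`, reading a radial clock
# `t* + F(r)` as `x⁰ + clock(q)`, and a late-time chart of the patch on small balls

For a centre `q`, a linear frame `A` with time row `(1,0,0,0)` (file IV-c) and the clock correction `F` (file IV-a),
the chart of the tame ball at `q` is, in Kerr–Schild coordinates, `Φ(y) = X(y) + (F(r_q) − F(r(X(y)))) ∂_{t*}`,
`X(y) = q + A y`: it is the affine chart `X` in CLOCK coordinates `(t* + F(r), x⃗)`, so that the clock reads
`x⁰ + clock(q)` along it EXACTLY (`clock_ballChart`). This file is the chart calculus (hypothesis-described `Φ`,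
`hΦ : ∀ y, Φ y = q + A y + (c − F ‖(q + A y)⃗‖) • ∂_{t*}`; no definitions):

* `Schw.spatial_ballChart`, `Schw.ballChart_apply_zero`, `Schw.ballChart_zero` — space part `(q + A y)⃗`, time part,
  centre `Φ 0 = q` (for `c = F(r_q)`);
* `Schw.exists_homeomorph_ballChart` — `Φ` is a HOMEOMORPHISM of `E4` (`x ↦ x + (c − F‖x⃗‖)∂_{t*}` is one, with inverse
  `x ↦ x − (c − F‖x⃗‖)∂_{t*}`, and `X` is affine invertible);
* `Schw.hasFDerivAt_ballChart` — off the axis `dΦ_y u = A u − F'(ρ)(⟪(q + A y)⃗, (A u)⃗⟫/ρ) ∂_{t*}`, `ρ = ‖(q + A y)⃗‖`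
  (`‖·‖' = ⟪z, ·⟫/‖z‖` from `‖z‖ = √(‖z‖²)`), hence `Φ` is `C^∞` there for smooth `F`;
* `Schw.clock_ballChart` — `(Φ y)⁰ + F(‖(Φ y)⃗‖) = y⁰ + (q⁰ + c)`;
* `Schw.isLateChart_ballChart` — for `‖A u‖ ≤ 3‖u‖` and `3r₀ < r_q − max r₁ 0` the restriction of `Φ` to the ball
  `B(0, r₀)` is a late-time chart (`Spacetime.IsLateChart`, threshold `−r₀`) of the patch `Kerr.spacetime M 0 r₁` into
  `univ`, with centre `q` and `dΨ = dΦ`.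

References: K. Martel, E. Poisson, Am. J. Phys. 69 (2001) 476, §II [MartelPoisson2001]; M. T. Anderson (2004), Def. 1.1
[Anderson2004]; J. M. Lee, *Introduction to Smooth Manifolds* (2013), Thm. 4.5 [LeeSmoothManifolds2013].
-/

noncomputable section
set_option maxSynthPendingDepth 3 -- nested operator types `E4 →L E4 →L E4 →L ℝ` (as in the tree files)
set_option linter.dupNamespace false -- `Summit.FinalStateConjecture.FinalStateConjecture.…` is the tree's layout

open TopologicalSpace Filter Topology Set Function Metric
open scoped ContDiff Topology InnerProductSpace Manifold

namespace Summit.FinalStateConjecture.FinalStateConjecture.Theorems.TameHull.Schw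

open Literature.Geometry.Lorentzian Schwarzschild
open Summit.FinalStateConjecture.FinalStateConjecture.Theorems.SeamedChartsExhaust.Negative

/-! ### The derivative of the Euclidean norm on `E3` -/

/-- `‖·‖` on `E3` is differentiable off `0` with `d‖·‖_z = ⟪z, ·⟫ / ‖z‖` (`‖z‖ = √(‖z‖²)`). [folklore] -/
theorem hasFDerivAt_norm_E3 {z : E3} (hz : z ≠ 0) : HasFDerivAt (norm : E3 → ℝ) (‖z‖⁻¹ • innerSL ℝ z) z := by
  have h1 := (hasStrictFDerivAt_norm_sq z).hasFDerivAt
  have hz2 : ‖z‖ ^ 2 ≠ 0 := pow_ne_zero 2 (norm_ne_zero_iff.mpr hz)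
  have h2 := h1.sqrt hz2
  have hf : (fun y : E3 ↦ √(‖y‖ ^ 2)) = norm := funext fun y ↦ Real.sqrt_sq (norm_nonneg y)
  rw [hf, Real.sqrt_sq (norm_nonneg z)] at h2
  refine h2.congr_fderiv (ContinuousLinearMap.ext fun v ↦ ?_)
  have hz0 : ‖z‖ ≠ 0 := norm_ne_zero_iff.mpr hz
  simp only [FunLike.coe_smul, Pi.smul_apply, innerSL_apply_apply, smul_eq_mul, one_div, two_smul,
    _root_.add_apply]
  field_simp
  ring

/-! ### The ball chart -/

section Chart

variable {q : E4} {A : E4 →L[ℝ] E4} {F : ℝ → ℝ} {c : ℝ} {Φ : E4 → E4}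
  (hΦ : ∀ y, Φ y = q + A y + (c - F (E4.spatialNorm (q + A y))) • E4.basisVector 0)
include hΦ

/-- The space part of the chart is that of the affine chart: `(Φ y)⃗ = (q + A y)⃗`. [folklore] -/
theorem spatial_ballChart (y : E4) :
    E4.spatial (Φ y) = E4.spatial (q + A y) ∧ E4.spatialNorm (Φ y) = E4.spatialNorm (q + A y) := by
  have h0 : E4.spatial (E4.basisVector 0) = 0 := by ext i; simp
  have h : E4.spatial (Φ y) = E4.spatial (q + A y) := by rw [hΦ, map_add, map_smul, h0, smul_zero, add_zero]
  exact ⟨h, by rw [E4.spatialNorm, E4.spatialNorm, h]⟩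

/-- The time part of the chart: `(Φ y)⁰ = q⁰ + (A y)⁰ + c − F ‖(q + A y)⃗‖`. [folklore] -/
theorem ballChart_apply_zero (y : E4) :
    Φ y 0 = q 0 + A y 0 + (c - F (E4.spatialNorm (q + A y))) := by
  rw [hΦ]
  simp

/-- **The chart is centred at `q`** when `c = F(r_q)`: `Φ 0 = q`. [folklore] -/
theorem ballChart_zero (hc : c = F (E4.spatialNorm q)) : Φ 0 = q := by
  rw [hΦ, map_zero, add_zero, hc, sub_self, zero_smul, add_zero]

/-- **The radial clock reads `x⁰ + clock(q)` along the chart**: if the time row of `A` is `(1, 0, 0, 0)`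
(`(A y)⁰ = y⁰`), then `(Φ y)⁰ + F ‖(Φ y)⃗‖ = y⁰ + (q⁰ + c)`. [cite: Anderson2004, Def. 1.1] -/
theorem clock_ballChart (hA0 : ∀ y, A y 0 = y 0) (y : E4) :
    Φ y 0 + F (E4.spatialNorm (Φ y)) = y 0 + (q 0 + c) := by
  rw [ballChart_apply_zero hΦ, (spatial_ballChart hΦ y).2, hA0]
  ring

/-- **The chart is a homeomorphism of `E4`** for invertible `A` and continuous `F`: the shear
`x ↦ x + (c − F ‖x⃗‖) ∂_{t*}` is a homeomorphism (it keeps `x⃗`, so `x ↦ x − (c − F ‖x⃗‖) ∂_{t*}` inverts it) and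
`y ↦ q + A y` is one. [folklore] -/
theorem exists_homeomorph_ballChart (A' : E4 ≃L[ℝ] E4) (hA : (A' : E4 →L[ℝ] E4) = A) (hF : Continuous F) :
    ∃ Θ : E4 ≃ₜ E4, ∀ y, Θ y = Φ y := by
  subst hA
  have h0 : E4.spatial (E4.basisVector 0) = 0 := by ext i; simp
  have hsp : ∀ (x : E4) (s : ℝ), E4.spatialNorm (x + s • E4.basisVector 0) = E4.spatialNorm x := fun x s ↦ by
    rw [E4.spatialNorm, E4.spatialNorm, map_add, map_smul, h0, smul_zero, add_zero]
  have hcont : Continuous fun x : E4 ↦ c - F (E4.spatialNorm x) :=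
    continuous_const.sub (hF.comp (continuous_norm.comp E4.spatial.continuous))
  -- the shear and its inverse
  let S : E4 ≃ₜ E4 :=
    { toFun := fun x ↦ x + (c - F (E4.spatialNorm x)) • E4.basisVector 0
      invFun := fun x ↦ x + (-(c - F (E4.spatialNorm x))) • E4.basisVector 0
      left_inv := fun x ↦ by
        simp only [hsp]
        rw [add_assoc, ← add_smul, add_neg_cancel, zero_smul, add_zero]
      right_inv := fun x ↦ by
        simp only [hsp]
        rw [add_assoc, ← add_smul, neg_add_cancel, zero_smul, add_zero]
      continuous_toFun := continuous_id.add (hcont.smul continuous_const)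
      continuous_invFun := continuous_id.add (hcont.neg.smul continuous_const) }
  refine ⟨(A'.toHomeomorph.trans (Homeomorph.addLeft q)).trans S, fun y ↦ ?_⟩
  rw [hΦ y]
  simp [S, Homeomorph.trans_apply]

/-- **The differential of the chart off the axis**: with `x = q + A y`, `ρ = ‖x⃗‖ > 0` and `F' (ρ) = p`,
`dΦ_y u = A u − p (⟪x⃗, (A u)⃗⟫/ρ) ∂_{t*}` (the clock-coordinate Jacobian `P ∘ A` of file IV-b).
[cite: MartelPoisson2001, §II] -/
theorem hasFDerivAt_ballChart {y : E4} (hρ : E4.spatial (q + A y) ≠ 0) {p : ℝ}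
    (hF : HasDerivAt F p (E4.spatialNorm (q + A y))) :
    HasFDerivAt Φ (A + (-(p • ((‖E4.spatial (q + A y)‖⁻¹ • innerSL ℝ (E4.spatial (q + A y))).comp
      (E4.spatial.comp A)))).smulRight (E4.basisVector 0)) y := by
  have hX : HasFDerivAt (fun y : E4 ↦ q + A y) A y := by
    simpa using (A.hasFDerivAt (x := y)).const_add q
  have hsp : HasFDerivAt (fun y : E4 ↦ E4.spatial (q + A y)) (E4.spatial.comp A) y :=
    E4.spatial.hasFDerivAt.comp y hX
  have hρ' : HasFDerivAt (fun y : E4 ↦ E4.spatialNorm (q + A y))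
      ((‖E4.spatial (q + A y)‖⁻¹ • innerSL ℝ (E4.spatial (q + A y))).comp (E4.spatial.comp A)) y :=
    (hasFDerivAt_norm_E3 hρ).comp y hsp
  have hFρ : HasFDerivAt (fun y : E4 ↦ c - F (E4.spatialNorm (q + A y)))
      (-(p • ((‖E4.spatial (q + A y)‖⁻¹ • innerSL ℝ (E4.spatial (q + A y))).comp (E4.spatial.comp A)))) y := by
    have := (hF.comp_hasFDerivAt y hρ').const_sub c
    simpa [neg_smul] using this
  have hfun : Φ = fun y ↦ (q + A y) + (c - F (E4.spatialNorm (q + A y))) • E4.basisVector 0 := funext hΦ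
  rw [hfun]
  exact hX.add (hFρ.smul_const (E4.basisVector 0))

/-- The differential of the chart applied to a vector, in the `sdot` notation of the Schwarzschild files:
`dΦ_y u = A u − (p ⟪x⃗, (A u)⃗⟫/ρ) ∂_{t*}`. [cite: MartelPoisson2001, §II] -/
theorem fderiv_ballChart_apply {y : E4} (hρ : E4.spatial (q + A y) ≠ 0) {p : ℝ}
    (hF : HasDerivAt F p (E4.spatialNorm (q + A y))) (u : E4) :
    fderiv ℝ Φ y u = A u - (p * (sdot (q + A y) (A u) / E4.spatialNorm (q + A y))) • E4.basisVector 0 := by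
  rw [(hasFDerivAt_ballChart hΦ hρ hF).fderiv]
  simp only [_root_.add_apply, ContinuousLinearMap.smulRight_apply, _root_.neg_apply, FunLike.coe_smul,
    Pi.smul_apply, ContinuousLinearMap.comp_apply, innerSL_apply_apply, smul_eq_mul, sdot, E4.spatialNorm]
  rw [sub_eq_add_neg, ← neg_smul]
  congr 1
  ring

/-- **The chart is `C^∞` off the axis** for smooth `F`. [folklore] -/
theorem contDiffAt_ballChart (hF : ContDiff ℝ ∞ F) {y : E4} (hρ : E4.spatial (q + A y) ≠ 0) : ContDiffAt ℝ ∞ Φ y := by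
  have hfun : Φ = fun y ↦ (q + A y) + (c - F (E4.spatialNorm (q + A y))) • E4.basisVector 0 := funext hΦ
  rw [hfun]
  have hX : ContDiff ℝ ∞ fun y : E4 ↦ q + A y := contDiff_const.add A.contDiff
  have hρ' : ContDiffAt ℝ ∞ (fun y : E4 ↦ E4.spatialNorm (q + A y)) y :=
    (contDiffAt_norm ℝ hρ).comp y (E4.spatial.contDiff.comp hX).contDiffAt
  exact hX.contDiffAt.add ((contDiffAt_const.sub (hF.contDiffAt.comp y hρ')).smul contDiffAt_const)

omit hΦ in
/-- **Space parts stay near the centre's**: `‖(q + A y)⃗ − q⃗‖ ≤ 3‖y‖` when `‖A u‖ ≤ 3‖u‖`, so on the ball `‖y‖ < r₀`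
the radius of the chart point lies in `(r_q − 3r₀, r_q + 3r₀)`. [folklore] -/
theorem spatialNorm_ballChart_bounds (hA3 : ∀ u, ‖A u‖ ≤ 3 * ‖u‖) (y : E4) :
    E4.spatialNorm q - 3 * ‖y‖ ≤ E4.spatialNorm (q + A y) ∧ E4.spatialNorm (q + A y) ≤ E4.spatialNorm q + 3 * ‖y‖ := by
  have h1 : ‖E4.spatial (A y)‖ ≤ 3 * ‖y‖ := by
    have : ‖E4.spatial (A y)‖ ≤ ‖A y‖ := by
      have h := Kerr.inner_eq_time_add_spatial (A y) (A y)
      rw [real_inner_self_eq_norm_sq, real_inner_self_eq_norm_sq] at h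
      nlinarith [norm_nonneg (E4.spatial (A y)), norm_nonneg (A y), sq_nonneg (A y 0)]
    exact this.trans (hA3 y)
  rw [E4.spatialNorm, E4.spatialNorm, map_add]
  constructor
  · have := norm_sub_le (E4.spatial q + E4.spatial (A y)) (E4.spatial (A y))
    rw [add_sub_cancel_right] at this
    linarith
  · linarith [norm_add_le (E4.spatial q) (E4.spatial (A y))]

end Chart

/-! ### The restriction to a small ball is a late-time chart of the patch -/

section Late

variable [Kerr.Facts] {M r₁ : ℝ} {hM : 0 ≤ M}

/-- **The ball chart is a late-time chart of the patch.** Let `q` be a point of the patch `{r > r₁}`, `A` an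
invertible frame with `‖A u‖ ≤ 3‖u‖`, `F` smooth, `c = F(r_q)` and `3 r₀ < r_q − max r₁ 0`, `0 < r₀`. Then
`Ψ : B(0, r₀) → {r > r₁}`, `Ψ y = Φ y`, is well defined and is a late-time chart modelled on the Minkowski background
over the ball after time `−r₀` into `univ` (smooth: `Φ` is `C^∞` on the ball, which avoids the axis; open embedding: `Φ`
is a homeomorphism of `E4`), CENTRED at `q` (`Ψ 0 = q`), with `dΨ_y = dΦ_y` on vectors. [cite: Anderson2004, Def. 1.1] -/
theorem isLateChart_ballChart (q : (Kerr.spacetime M 0 r₁ hM).carrier) (A : E4 →L[ℝ] E4) (A' : E4 ≃L[ℝ] E4)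
    (hA : (A' : E4 →L[ℝ] E4) = A) (hA3 : ∀ u, ‖A u‖ ≤ 3 * ‖u‖) {F : ℝ → ℝ} (hF : ContDiff ℝ ∞ F) {r₀ : ℝ}
    (hr₀ : 0 < r₀) (hr : 3 * r₀ < E4.spatialNorm q.1 - max r₁ 0) :
    let U : Opens E4 := ⟨Metric.ball (0 : E4) r₀, Metric.isOpen_ball⟩
    ∃ Ψ : U → (Kerr.spacetime M 0 r₁ hM).carrier,
      (∀ y : U, (Ψ y).1 = q.1 + A y.1 +
        (F (E4.spatialNorm q.1) - F (E4.spatialNorm (q.1 + A y.1))) • E4.basisVector 0) ∧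
      (Kerr.spacetime M 0 r₁ hM).IsLateChart (Minkowski.backgroundOn U) Set.univ (-r₀) Ψ ∧
      (∃ x : U, (x : E4) = 0 ∧ Ψ x = q) ∧
      ∀ (y : U) (u : E4), mfderiv 𝓘(ℝ, E4) (𝓡 4) Ψ y u =
        fderiv ℝ (fun z : E4 ↦ q.1 + A z + (F (E4.spatialNorm q.1) - F (E4.spatialNorm (q.1 + A z))) •
          E4.basisVector 0) y.1 u := by
  intro U
  set Φ : E4 → E4 := fun z ↦ q.1 + A z +
    (F (E4.spatialNorm q.1) - F (E4.spatialNorm (q.1 + A z))) • E4.basisVector 0 with hΦdef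
  have hΦ : ∀ y, Φ y = q.1 + A y + (F (E4.spatialNorm q.1) - F (E4.spatialNorm (q.1 + A y))) • E4.basisVector 0 :=
    fun _ ↦ rfl
  -- points of the ball are mapped into the patch, off the axis
  have hmax : 0 ≤ max r₁ 0 := le_max_right _ _
  have hball : ∀ y : E4, ‖y‖ < r₀ → max r₁ 0 < E4.spatialNorm (q.1 + A y) ∧ E4.spatial (q.1 + A y) ≠ 0 := by
    intro y hy
    have hb := (spatialNorm_ballChart_bounds (q := q.1) hA3 y).1
    have h1 : max r₁ 0 < E4.spatialNorm (q.1 + A y) := by linarith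
    refine ⟨h1, fun h ↦ ?_⟩
    have : E4.spatialNorm (q.1 + A y) = 0 := by rw [E4.spatialNorm, h, norm_zero]
    linarith
  have hmem : ∀ y : U, Φ y.1 ∈ Kerr.region (0 : ℝ) r₁ := fun y ↦ by
    show max r₁ 0 < Kerr.radius 0 (Φ y.1)
    rw [Kerr.radius_zero_left, (spatial_ballChart hΦ y.1).2]
    exact (hball y.1 (mem_ball_zero_iff.mp y.2)).1
  set Ψ : U → Kerr.region (0 : ℝ) r₁ := fun y ↦ ⟨Φ y.1, hmem y⟩ with hΨ
  -- smoothness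
  have hsmooth : ContMDiff 𝓘(ℝ, E4) 𝓘(ℝ, E4) ∞ Ψ := by
    intro y
    rw [← ContMDiffAt.subtypeVal_comp_iff]
    exact (OpensChart.contMDiffAt_iff y (Subtype.val ∘ Ψ) Φ (fun _ ↦ rfl)).mpr
      (contDiffAt_ballChart hΦ hF (hball y.1 (mem_ball_zero_iff.mp y.2)).2)
  -- the differential
  have hmf : ∀ (y : U) (u : E4), mfderiv 𝓘(ℝ, E4) 𝓘(ℝ, E4) Ψ y u = fderiv ℝ Φ y.1 u := by
    intro y u
    have hd : DifferentiableAt ℝ Φ y.1 :=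
      (contDiffAt_ballChart hΦ hF (hball y.1 (mem_ball_zero_iff.mp y.2)).2).differentiableAt (by simp)
    have h1 : MDifferentiableAt 𝓘(ℝ, E4) 𝓘(ℝ, E4) (Subtype.val : Kerr.region (0 : ℝ) r₁ → E4) (Ψ y) :=
      (contMDiff_subtype_val (I := 𝓘(ℝ, E4)) (n := ∞)).mdifferentiableAt (by simp)
    have h2 : MDifferentiableAt 𝓘(ℝ, E4) 𝓘(ℝ, E4) Ψ y := (hsmooth y).mdifferentiableAt (by simp)
    have hc := mfderiv_comp y h1 h2
    have h3 := DFunLike.congr_fun hc u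
    rw [OpensChart.mfderiv_eq y (Subtype.val ∘ Ψ) Φ (fun _ ↦ rfl) hd] at h3
    simp only [Function.comp_apply] at h3
    erw [OpensChart.mfderiv_subtypeVal_apply] at h3
    exact h3.symm
  -- open embedding: `Φ` is a homeomorphism of `E4`
  obtain ⟨Θ, hΘ⟩ := exists_homeomorph_ballChart hΦ A' hA hF.continuous
  have hemb : IsOpenEmbedding Ψ := by
    have hg : IsOpenEmbedding (Subtype.val ∘ Ψ) := by
      have : Subtype.val ∘ Ψ = Θ ∘ (Subtype.val : U → E4) := funext fun y ↦ (hΘ y.1).symm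
      rw [this]
      exact Θ.isOpenEmbedding.comp U.2.isOpenEmbedding_subtypeVal
    exact IsOpenEmbedding.of_comp _ (Kerr.region (0 : ℝ) r₁).2.isOpenEmbedding_subtypeVal hg
  have hlate : IsOpen ((Minkowski.backgroundOn U).lateRegion (-r₀)) :=
    isOpen_lt continuous_const ((PiLp.continuous_apply 2 _ 0).comp continuous_subtype_val)
  refine ⟨Ψ, fun y ↦ rfl, ⟨hsmooth, hemb.comp hlate.isOpenEmbedding_subtypeVal, fun _ _ ↦ mem_univ _⟩,
    ⟨⟨0, mem_ball_self hr₀⟩, rfl, Subtype.ext (ballChart_zero hΦ rfl)⟩, hmf⟩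

end Late

/-- Registered summary (stmt-FinalStateConjecture-17430, route seat 1): **the ball chart in clock coordinates reads the
radial clock `t* + F(r)` as `x⁰ + clock(q)` exactly.** [cite: Anderson2004, Def. 1.1] -/
theorem schwarzschild_ballChart_clock : ∀ {q : E4} {A : E4 →L[ℝ] E4} {F : ℝ → ℝ} {c : ℝ} {Φ : E4 → E4}, (∀ y, Φ y = q + A y + (c - F (E4.spatialNorm (q + A y))) • E4.basisVector 0) → (∀ y, A y 0 = y 0) → ∀ y, Φ y 0 + F (E4.spatialNorm (Φ y)) = y 0 + (q 0 + c) :=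
  fun hΦ hA0 y ↦ clock_ballChart hΦ hA0 y

end Summit.FinalStateConjecture.FinalStateConjecture.Theorems.TameHull.Schw

end
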